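import Mathlib
import HarnessLib
import Summits.ResolutionOfSingularities.ResolutionOfSingularities.Theorems.WildQuotientsWildQuotientResolutionGluedQuotientPieces
import Summits.ResolutionOfSingularities.ResolutionOfSingularities.Theorems.WildQuotientsWildQuotientResolutionCyclicTransferInvariants
import Summits.ResolutionOfSingularities.ResolutionOfSingularities.Theorems.WildQuotientsWildQuotientResolutionCyclicTransferStalkAugRestrict
import Literature.AlgebraicGeometry.Resolution.ProjectiveSpaceRegular
import Literature.AlgebraicGeometry.Resolution.ResolutionGlue

/-!
# A single piece `O/G` of a glued quotient is regular in the Király–Lütkebohmert terminal state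

Crux stmt-ResolutionOfSingularities-15640 (`WildQuotients.WildQuotientResolution`), line `Sketch`;
programme V3U of CHAIN w45c v5, RULING v5.1 row **V3U-F-W** (res-L1-w45c-stub-3): the chart-`b`
half of the final assembly as stand-alone lemmas. [OURS · L1 W4.5c] — NOT a statement of the
manuscript.

* `isRegular_pieceQuot_of_isRegularRing` (F-W0): over an AFFINE base, the piece `O/G` of
  `ActionOver.glued` is regular as soon as the invariant ring `Γ(O, ⊤)^G` is a regular ring
  (`O/G ≅ Spec Γ(O,⊤)^G`, `BlowupExit.exists_iso_spec_pieceQuot` p486067 + `Scheme.isRegular_Spec`).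
* `isRegular_pieceQuot_of_stalkAug` (F-W0′): the one-piece form of p459590's `cdt_isRegular_glued` —
  `|G| = p`, `X` integral and locally of finite type over a locally Noetherian affine base, the
  `G`-stable open `O` (affine over the base) REGULAR, and the augmentation ideal of the stalk action
  principal at every fixed point LYING IN `O` ⟹ `O/G` is regular (chart-level Király–Lütkebohmert,
  `CyclicTransfer.isRegularRing_invariantsRing_of_locallyOfFiniteType`, via `stub_stalkAug_restrict`).
  No hypothesis on the points of `X` outside `O`: this is what the V3U model needs, where the lifted
  action is terminal on the chart-`b` piece `W_b` but NOT on the `A₁`-cone chart.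
Consumer: V3U-F (`Y_b = W_b/σ` regular ⇒ the `W` of `BlowupExit.hasResolution_of_isBlowup_local`).
-/

-- single-problem summit: the doubled namespace component `ResolutionOfSingularities` is forced
set_option linter.dupNamespace false

noncomputable section

open CategoryTheory AlgebraicGeometry TopologicalSpace
open Literature.AlgebraicGeometry.Resolution Literature.AlgebraicGeometry.RelativeSpec

namespace Summit.ResolutionOfSingularities.ResolutionOfSingularities.Theorems.WildQuotientResolution.BlowupExit

variable {X S : Scheme.{0}} {r : X ⟶ S} {G : Type} [Group G] [Finite G] (ρ : ActionOver r G)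
  [IsSeparated r]

/-- **F-W0: a piece `O/G` over an affine base is regular when its invariant ring is.**
(`O/G ≅ Spec Γ(O, (O → S)⁻¹⊤)^G` by `exists_iso_spec_pieceQuot`; the spectrum of a regular ring is a
regular scheme.) [folklore] -/
theorem isRegular_pieceQuot_of_isRegularRing [IsAffine S] (O : ρ.StableAffineOpens)
    (hreg : IsRegularRing ((ρ.restrict O.1 O.2.1).invariantsRing ⊤)) :
    Scheme.IsRegular (ρ.pieceQuot O) := by
  obtain ⟨e, -⟩ := exists_iso_spec_pieceQuot ρ O
  haveI : IsRegularRing (CommRingCat.of ((ρ.restrict O.1 O.2.1).invariantsRing ⊤)) := hreg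
  exact Scheme.IsRegular.of_iso e.hom (Scheme.isRegular_Spec _)

/-- **F-W0′: a piece `O/G` is regular in the Király–Lütkebohmert terminal state ON THAT PIECE.**
`G` of prime order `p` acting over an affine locally Noetherian base `S` on the integral `X`
(locally of finite type over `S`); `O` a `G`-stable open of `X`, affine over `S`, which is REGULAR
and at whose `G`-fixed points the augmentation ideals of the stalk actions are principal. Then the
piece `O/G` of the glued quotient is a regular scheme: for `O` empty it is empty; otherwise `O` is a
regular integral scheme carrying the restricted action with the same stalk hypothesis
(`CyclicTransfer.stub_stalkAug_restrict`), so its invariant ring over `⊤` is regular by the chart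
form of the cyclic transfer (`CyclicTransfer.isRegularRing_invariantsRing_of_locallyOfFiniteType`),
and F-W0 applies. [cite: KiralyLutkebohmert2013, Thm 2] [cite: SGA1, Exp. V, §1, Prop. 1.8] -/
theorem isRegular_pieceQuot_of_stalkAug {p : ℕ} (hp : p.Prime) (hcard : Nat.card G = p)
    [IsAffine S] [IsLocallyNoetherian S] [IsIntegral X] [LocallyOfFiniteType r]
    (O : ρ.StableAffineOpens) (hOreg : Scheme.IsRegular (O.1 : Scheme.{0}))
    (hdiv : ∀ (g : G) (x : X) (_ : x ∈ O.1) (hx : (ρ.aut g).hom.base x = x),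
      (Ideal.span (Set.range fun s : X.presheaf.stalk x =>
        (X.presheaf.stalkSpecializes (specializes_of_eq hx) ≫ (ρ.aut g).hom.stalkMap x).hom s -
          s)).IsPrincipal) :
    Scheme.IsRegular (ρ.pieceQuot O) := by
  classical
  by_cases hO : Nonempty (O.1 : Scheme.{0})
  · -- the restricted action on the non-empty stable open `O`, affine over `S`
    haveI := hO
    haveI : IsIntegral (O.1 : Scheme.{0}) := isIntegral_of_isOpenImmersion O.1.ι
    set ρO := ρ.restrict O.1 O.2.1 with hρO
    have hdivO : ∀ (g : G) (x : (O.1 : Scheme.{0})) (hx : (ρO.aut g).hom.base x = x),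
        (Ideal.span (Set.range fun s : (O.1 : Scheme.{0}).presheaf.stalk x =>
          ((O.1 : Scheme.{0}).presheaf.stalkSpecializes (specializes_of_eq hx) ≫
            (ρO.aut g).hom.stalkMap x).hom s - s)).IsPrincipal := by
      intro g x hx
      have hgx : (ρ.aut g).hom.base x.1 = x.1 := by
        have h1 := ρ.ι_restrictHom_apply O.1 O.2.1 g x
        simp only [Scheme.Opens.ι_apply] at h1
        rw [← ActionOver.restrict_aut_hom] at h1
        rw [← h1]
        exact congrArg Subtype.val hx
      obtain ⟨_, h⟩ := CyclicTransfer.stub_stalkAug_restrict ρ O.1 O.2.1 g x hgx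
        (hdiv g x.1 x.2 hgx)
      exact h
    exact isRegular_pieceQuot_of_isRegularRing ρ O
      (CyclicTransfer.isRegularRing_invariantsRing_of_locallyOfFiniteType ρO hp hcard hOreg
        ⟨⊤, isAffineOpen_top S⟩ hdivO)
  · -- empty stable open: the piece is empty
    intro y
    obtain ⟨x, -⟩ := (ρ.restrict O.1 O.2.1).surjective_toQuotient'.1 y
    exact absurd ⟨x⟩ hO

end Summit.ResolutionOfSingularities.ResolutionOfSingularities.Theorems.WildQuotientResolution.BlowupExit

end
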